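import Summits.BirchSwinnertonDyer.Rank1Residual.F1Sign2.RhombicSymbolCongruence
import Literature.NumberTheory.EllipticCurves.PAdicLFunctionDistributionHoldsProofs
import Literature.NumberTheory.EllipticCurves.ModularSymbolsEichlerShimuraHoldsProofs
import Literature.NumberTheory.EllipticCurves.ModularFormsGamma0Genus
import Literature.NumberTheory.EllipticCurves.ModularSymbolsNormalizedSymbolProofs
import Literature.NumberTheory.EllipticCurves.PAdicLFunctionIntegralityProofs
import Literature.NumberTheory.EllipticCurves.PAdicLFunctionMinusIntegralityAtTwoProofs
import Literature.NumberTheory.EllipticCurves.PAdicLFunctionProofs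
import HarnessLib

/-!
# Cell `bsd-f1-sign2` (`p = 2`, non-CM) — IMC lens g1: PROOF of the rhombic symbol congruence
# `rhombicSymbolCongruence_holds : RhombicSymbolCongruence` (candidate IMC-A♮sym is a THEOREM) and of the
# exact finite-layer congruence `layerCongruenceAtTwo_of_rhombic` (IMC-LAYER for every reduction type)

PROOF FILE (typer seat `bsd-f1-sign2-ty`, TURNKEY filing asked by the planner-of-record bsd-f1-sign2-imc g1,
STATUS 2026-08-27T15:28:23Z): theorems only — no definition, no named fact, no `@[conjecture]`; the
obligation node `RhombicSymbolCongruence` (sibling statement file `F1Sign2/RhombicSymbolCongruence.lean`,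
p542318, where it keeps its `@[conjecture]` tag — this sibling `…Holds`-style file closes it BY NAME, per the
conjecture-leaf convention) is PROVED here. Source: `HOME/MEMO-imc-data/Sketch.lean` v3 sha16
40f60413d52aeecb §A (planner's kernel-checked proof: `lean check` rc 0, 0 warnings, 0 sorries,
`#print axioms` = [propext, Classical.choice, Quot.sound]), re-filed VERBATIM except the name
`rhombicSymbolCongruence` ↦ `rhombicSymbolCongruence_holds`. PARTITION: none moved (a symbol-level theorem;
no census cell of the leaf changes). Beyond-print: the STATEMENT at 2-power cusps was not found in print by
REF2 g1/g2 (ingredients: Cremona *Algorithms* §2.8/§2.10 lattice types, Manin cusp classes) — REF2 places it.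

MATHEMATICS (MEMO-imc §10): pure lattice algebra (`re_div_sub_im_div_of_rhombic`): for a
conjugation-stable additive subgroup `Λ ⊆ ℂ` with `re Λ = ℤ·Ωp/2`, `im Λ = ℤ·Ωm/2` (`Ωp, Ωm > 0`; the
tree's normalisation of `plusPeriod` / `minusPeriod`) which is RHOMBIC (`∃ z ∈ Λ, re z ∉ Λ`), the integer
coordinates `(2 re z/Ωp, 2 im z/Ωm)` of every `z ∈ Λ` have EQUAL PARITY, i.e. `re z/Ωp − im z/Ωm ∈ ℤ`
(`Ωp, iΩm ∈ Λ` from `z + z̄`, `z − z̄`; a `z` with coordinates of distinct parity would put `Ωp/2` or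
`iΩm/2` in `Λ`, and then `re z₀ ∈ Λ` for the rhombic witness `z₀`). Then `RhombicSymbolCongruence` follows
from the cusp-class lemmas of the tree (`modularSymbol_div_sub_zero_mem_periodLattice` for odd `N`,
`modularSymbol_div_sub_half_mem_periodLattice` for `2 ∥ N`; packaged as
`modularSymbol_twoPow_sub_half_mem`), `im {∞, 1/2} = 0` (`im_modularSymbol_half`), and the identities
`[r]⁺ = re{∞,r}/Ω⁺`, `[r]⁻ = im{∞,r}/Ω⁻` (`plusSymbol_eq_re_holds`, `minusSymbol_eq_im_mul_I_holds`,
`ratCast_ratPlusSymbol_holds`, `ratCast_ratMinusSymbol`).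

BC5 (unchanged, now explained): ENGINE D2 T1 415/420 and T4 2490/2490 (the 5 + 0 exceptions are non-`Λ_f`
models, outside the theorem's hypothesis `IsRhombic f` on the NEWFORM lattice).

References: [CremonaAlgorithms1997] §2.8, §2.10; [Manin1972] Cor. 3.6; [MazurTateTeitelbaum1986Invent]
§I.8; HOME MEMO-imc.md §10, MEMO-imc-data/Sketch.lean v3 40f60413d52aeecb.
-/

set_option autoImplicit false

noncomputable section

open scoped Classical MatrixGroups ModularForm

open CongruenceSubgroup Polynomial WeierstrassCurve Literature.NumberTheory.EllipticCurves
  Literature.NumberTheory.EllipticCurves.ModularForms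

namespace Summit.BirchSwinnertonDyer.Rank1Residual.F1Sign2

section RhombicAlgebra

/-- **Rhombic parity lemma** (lattice algebra; Cremona 1997 §2.8 / §2.10 bookkeeping — the two lattice
types): see the module docstring. [cite: CremonaAlgorithms1997, §2.8 (real and imaginary periods; the parity bookkeeping is ours)] -/
theorem re_div_sub_im_div_of_rhombic (Λ : AddSubgroup ℂ)
    (hconj : ∀ z ∈ Λ, (starRingEnd ℂ) z ∈ Λ) {Ωp Ωm : ℝ} (hp : 0 < Ωp) (hm : 0 < Ωm)
    (hre : Λ.map Complex.reLm.toAddMonoidHom = AddSubgroup.zmultiples (Ωp / 2))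
    (him : Λ.map Complex.imLm.toAddMonoidHom = AddSubgroup.zmultiples (Ωm / 2))
    (hrh : ∃ z ∈ Λ, ((z.re : ℂ)) ∉ Λ) :
    ∀ z ∈ Λ, ∃ k : ℤ, z.re / Ωp - z.im / Ωm = k := by
  -- integer coordinates of lattice points
  have hu : ∀ z ∈ Λ, ∃ u : ℤ, z.re = u * (Ωp / 2) := by
    intro z hz
    have h : z.re ∈ Λ.map Complex.reLm.toAddMonoidHom := AddSubgroup.mem_map_of_mem _ hz
    rw [hre, AddSubgroup.mem_zmultiples_iff] at h
    obtain ⟨u, hu⟩ := h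
    exact ⟨u, by rw [zsmul_eq_mul] at hu; exact hu.symm⟩
  have hv : ∀ z ∈ Λ, ∃ v : ℤ, z.im = v * (Ωm / 2) := by
    intro z hz
    have h : z.im ∈ Λ.map Complex.imLm.toAddMonoidHom := AddSubgroup.mem_map_of_mem _ hz
    rw [him, AddSubgroup.mem_zmultiples_iff] at h
    obtain ⟨v, hv⟩ := h
    exact ⟨v, by rw [zsmul_eq_mul] at hv; exact hv.symm⟩
  -- the full real and imaginary periods lie in `Λ`
  have hΩp : ((Ωp : ℝ) : ℂ) ∈ Λ := by
    have h : Ωp / 2 ∈ Λ.map Complex.reLm.toAddMonoidHom := by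
      rw [hre]; exact AddSubgroup.mem_zmultiples _
    obtain ⟨w, hw, hwre⟩ := AddSubgroup.mem_map.mp h
    have hwre' : w.re = Ωp / 2 := hwre
    have h2 : w + (starRingEnd ℂ) w ∈ Λ := Λ.add_mem hw (hconj w hw)
    rw [Complex.add_conj, hwre', show (2 : ℝ) * (Ωp / 2) = Ωp by ring] at h2
    exact h2
  have hΩm : ((Ωm : ℝ) : ℂ) * Complex.I ∈ Λ := by
    have h : Ωm / 2 ∈ Λ.map Complex.imLm.toAddMonoidHom := by
      rw [him]; exact AddSubgroup.mem_zmultiples _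
    obtain ⟨w, hw, hwim⟩ := AddSubgroup.mem_map.mp h
    have hwim' : w.im = Ωm / 2 := hwim
    have h2 : w - (starRingEnd ℂ) w ∈ Λ := Λ.sub_mem hw (hconj w hw)
    rw [Complex.sub_conj, hwim', show (2 : ℝ) * (Ωm / 2) = Ωm by ring] at h2
    exact h2
  -- rhombic: neither half-period lies in `Λ`
  obtain ⟨z₀, hz₀, hz₀re⟩ := hrh
  have hnp : ((Ωp / 2 : ℝ) : ℂ) ∉ Λ := by
    intro hmem
    obtain ⟨u₀, hu₀⟩ := hu z₀ hz₀
    apply hz₀re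
    have h1 : ((z₀.re : ℝ) : ℂ) = u₀ • (((Ωp / 2 : ℝ)) : ℂ) := by
      rw [hu₀, zsmul_eq_mul]; push_cast; ring
    rw [h1]
    exact Λ.zsmul_mem hmem u₀
  have hnm : ((Ωm / 2 : ℝ) : ℂ) * Complex.I ∉ Λ := by
    intro hmem
    obtain ⟨v₀, hv₀⟩ := hv z₀ hz₀
    apply hz₀re
    have h1 : ((z₀.im : ℝ) : ℂ) * Complex.I = v₀ • ((((Ωm / 2 : ℝ)) : ℂ) * Complex.I) := by
      rw [hv₀, zsmul_eq_mul]; push_cast; ring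
    have hzim : ((z₀.im : ℝ) : ℂ) * Complex.I ∈ Λ := by
      rw [h1]; exact Λ.zsmul_mem hmem v₀
    have h2 : ((z₀.re : ℝ) : ℂ) = z₀ - ((z₀.im : ℝ) : ℂ) * Complex.I := by
      rw [eq_sub_iff_add_eq]; exact Complex.re_add_im z₀
    rw [h2]
    exact Λ.sub_mem hz₀ hzim
  -- main step: equal parity of the two coordinates
  intro z hz
  obtain ⟨u, huz⟩ := hu z hz
  obtain ⟨v, hvz⟩ := hv z hz
  have hmemJL : ∀ j l : ℤ, z - j • ((Ωp : ℝ) : ℂ) - l • (((Ωm : ℝ) : ℂ) * Complex.I) ∈ Λ :=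
    fun j l => Λ.sub_mem (Λ.sub_mem hz (Λ.zsmul_mem hΩp j)) (Λ.zsmul_mem hΩm l)
  have hpar : Even u ↔ Even v := by
    constructor
    · intro heu
      by_contra hov
      obtain ⟨j, hj⟩ := heu
      obtain ⟨l, hl⟩ := Int.not_even_iff_odd.mp hov
      apply hnm
      have h2 : z - j • ((Ωp : ℝ) : ℂ) - l • (((Ωm : ℝ) : ℂ) * Complex.I)
          = ((Ωm / 2 : ℝ) : ℂ) * Complex.I := by
        rw [← Complex.re_add_im z, huz, hvz, hj, hl]
        simp only [zsmul_eq_mul]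
        push_cast
        ring
      rw [← h2]
      exact hmemJL j l
    · intro hev
      by_contra hou
      obtain ⟨j, hj⟩ := Int.not_even_iff_odd.mp hou
      obtain ⟨l, hl⟩ := hev
      apply hnp
      have h2 : z - j • ((Ωp : ℝ) : ℂ) - l • (((Ωm : ℝ) : ℂ) * Complex.I)
          = ((Ωp / 2 : ℝ) : ℂ) := by
        rw [← Complex.re_add_im z, huz, hvz, hj, hl]
        simp only [zsmul_eq_mul]
        push_cast
        ring
      rw [← h2]
      exact hmemJL j l
  obtain ⟨k, hk⟩ := (Int.even_sub.mpr hpar)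
  refine ⟨k, ?_⟩
  have hk' : (u : ℝ) - (v : ℝ) = (k : ℝ) + (k : ℝ) := by exact_mod_cast hk
  have e1 : (u : ℝ) * (Ωp / 2) / Ωp = u / 2 := by rw [div_eq_iff hp.ne']; ring
  have e2 : (v : ℝ) * (Ωm / 2) / Ωm = v / 2 := by rw [div_eq_iff hm.ne']; ring
  rw [huz, hvz, e1, e2]
  linarith

/-- **Cusp class of `a/2^m` (`a` odd, `m ≥ 1`) when `4 ∤ N`**: `{∞, a/2^m}_f − {∞, 1/2}_f ∈ Λ_f`
(odd `N`: both cusps are equivalent to `0`, `modularSymbol_div_sub_zero_mem_periodLattice`;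
`N = 2M`, `M` odd: `modularSymbol_div_sub_half_mem_periodLattice`). [cite: Manin1972, Cor. 3.6 (cusp classes; the 2-power bookkeeping is ours)] -/
theorem modularSymbol_twoPow_sub_half_mem {N : ℕ} [NeZero N] (f : CuspForm (Gamma0 N) 2)
    (h4 : ¬ 4 ∣ N) {a : ℤ} {m : ℕ} (ha : Odd a) (hm : 1 ≤ m) :
    modularSymbol f ((a : ℚ) / 2 ^ m) - modularSymbol f (1 / 2) ∈ periodLattice f := by
  have h2a : IsCoprime (2 : ℤ) a := by
    obtain ⟨j, hj⟩ := ha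
    exact ⟨-j, 1, by rw [hj]; ring⟩
  have hc0 : (2 : ℤ) ^ m ≠ 0 := pow_ne_zero _ two_ne_zero
  rcases Nat.even_or_odd N with hN | hN
  · -- `N = 2M` with `M` odd
    obtain ⟨M, hM⟩ := hN
    have hMo : Odd M := by
      rcases Nat.even_or_odd M with hMe | hMo
      · obtain ⟨t, ht⟩ := hMe
        exact absurd ⟨t, by omega⟩ h4
      · exact hMo
    have h2M : IsCoprime (2 : ℤ) (M : ℤ) := by
      obtain ⟨t, ht⟩ := hMo
      exact ⟨-(t : ℤ), 1, by rw [ht]; push_cast; ring⟩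
    have hN' : (N : ℤ) = 2 * (M : ℤ) := by rw [hM]; push_cast; ring
    have hc : (2 : ℤ) ^ m = 2 * 2 ^ (m - 1) := by
      rw [← pow_succ', Nat.sub_add_cancel hm]
    have h := modularSymbol_div_sub_half_mem_periodLattice f hN' hc hc0 (h2a.symm.pow_right)
      (h2M.pow_left)
    push_cast at h
    exact h
  · -- `N` odd: both cusps are `Γ₀(N)`-equivalent to `0`
    have h2N : IsCoprime (2 : ℤ) (N : ℤ) := by
      obtain ⟨t, ht⟩ := hN
      exact ⟨-(t : ℤ), 1, by rw [ht]; push_cast; ring⟩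
    have hA := modularSymbol_div_sub_zero_mem_periodLattice f (B := a) (D := 2 ^ m) hc0
      ((h2a.mul_right h2N).pow_left)
    have hB := modularSymbol_div_sub_zero_mem_periodLattice f (B := 1) (D := 2) two_ne_zero
      (by simpa using h2N)
    have h := (periodLattice f).sub_mem hA hB
    push_cast at h
    simpa [sub_sub_sub_cancel_right] using h

/-- **A♮sym is a theorem**: `RhombicSymbolCongruence` holds (rhombic parity lemma + cusp class +
`im {∞, 1/2} = 0` + the `[r]^±` normalisations of the tree). Closes the obligation node
`RhombicSymbolCongruence` of `F1Sign2/RhombicSymbolCongruence.lean` BY NAME. [folklore] -/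
theorem rhombicSymbolCongruence_holds : RhombicSymbolCongruence := by
  intro N _ f hf hQ h4 hrh a m ha hm
  have hreal : ∀ n, (cuspCoeff f n).im = 0 := cuspCoeff_im_eq_zero_of_coeffField_eq_bot hQ
  have hz := modularSymbol_twoPow_sub_half_mem f h4 ha hm
  obtain ⟨hΩp, hre⟩ := plusPeriod_pos_and_realPeriods_eq isZLattice_periodLattice_holds hf hQ
  have hΩm : 0 < minusPeriod f := IsNewform0.minusPeriod_pos_holds hf hQ
  have him : imagPeriods f = AddSubgroup.zmultiples (minusPeriod f / 2) := by
    rcases minusPeriod_eq_zero_or f with h0 | ⟨_, h⟩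
    · exact absurd h0 hΩm.ne'
    · exact h
  have hconj : ∀ z ∈ periodLattice f, (starRingEnd ℂ) z ∈ periodLattice f :=
    fun z hz => conj_mem_periodLattice_holds hf hQ hz
  obtain ⟨k, hk⟩ := re_div_sub_im_div_of_rhombic (periodLattice f) hconj hΩp hΩm hre him hrh _ hz
  refine ⟨k, ?_⟩
  have hPr := ratCast_ratPlusSymbol_holds hf hQ ((a : ℚ) / 2 ^ m)
  have hPh := ratCast_ratPlusSymbol_holds hf hQ (1 / 2)
  have hMr := ratCast_ratMinusSymbol f hf hQ ((a : ℚ) / 2 ^ m)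
  have e1 : normalizedPlusSymbol f ((a : ℚ) / 2 ^ m)
      = (modularSymbol f ((a : ℚ) / 2 ^ m)).re / plusPeriod f := by
    rw [normalizedPlusSymbol, plusSymbol_eq_re_holds f hreal, Complex.ofReal_re]
  have e2 : normalizedPlusSymbol f (1 / 2) = (modularSymbol f (1 / 2)).re / plusPeriod f := by
    rw [normalizedPlusSymbol, plusSymbol_eq_re_holds f hreal, Complex.ofReal_re]
  have e3 : normalizedMinusSymbol f ((a : ℚ) / 2 ^ m)
      = (modularSymbol f ((a : ℚ) / 2 ^ m)).im / minusPeriod f := by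
    rw [normalizedMinusSymbol, minusSymbol_eq_im_mul_I_holds f hreal, Complex.mul_im,
      Complex.ofReal_re, Complex.ofReal_im, Complex.I_re, Complex.I_im]
    ring
  have h0 : (modularSymbol f (1 / 2)).im = 0 := im_modularSymbol_half f hreal
  rw [Complex.sub_re, Complex.sub_im, h0, sub_zero, sub_div] at hk
  have key : ((ratPlusSymbol f ((a : ℚ) / 2 ^ m) : ℚ) : ℝ)
      - ((ratMinusSymbol f ((a : ℚ) / 2 ^ m) : ℚ) : ℝ)
      = ((ratPlusSymbol f (1 / 2) : ℚ) : ℝ) + (k : ℝ) := by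
    rw [hPr, hPh, hMr, e1, e2, e3]
    linarith
  exact_mod_cast key

/-- Corollary (all reduction types, `4 ∤ N`): the EXACT finite-layer congruence
`LayerCongruenceAtTwo f` for every rational newform with rhombic period lattice. [folklore] -/
theorem layerCongruenceAtTwo_of_rhombic {N : ℕ} [NeZero N] (f : CuspForm (Gamma0 N) 2)
    (hf : IsNewform0 f) (hQ : coeffField f = ⊥) (h4 : ¬ 4 ∣ N) (hrh : IsRhombic f) :
    LayerCongruenceAtTwo f :=
  layerCongruence_of_symbolCongruence f (rhombicSymbolCongruence_holds f hf hQ h4 hrh)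

end RhombicAlgebra

end Summit.BirchSwinnertonDyer.Rank1Residual.F1Sign2

end
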